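import Literature.GroupTheory.CombinatorialGroupTheory.QuadraticWords
import Mathlib.GroupTheory.Perm.Cycle.Basic
import Mathlib.GroupTheory.Perm.List
import HarnessLib

/-!
# Vertices of an alternating quadratic word: the vertex permutation (definitions)

Topic `Literature/GroupTheory/CombinatorialGroupTheory`.  When the sides of a polygon are glued
according to an alternating quadratic word `w` (every symbol once with each exponent; ZVC §1.3,
§3.1), the corners of the polygon fall into classes = the VERTICES of the resulting closed
orientable surface, and `V - E + F = 2 - 2g` (`E` = number of symbols, `F = 1`).  We record the
vertices without any topology, in the "letters" formalism: the corner in front of a letter `x` is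
named by `x` itself (the letters of a quadratic word are pairwise distinct), and the corner in
front of `x` is identified with the corner behind the partner letter `x̄ = (x.1, !x.2)`, i.e. with
the corner in front of the cyclic successor of `x̄`.  Hence the classes of corners are the cycles,
on the letters of `w`, of the **vertex permutation**

  `vertexPerm w = formPerm w ∘ bar`,   `x ↦ (cyclic successor in w of x̄)`

(`List.formPerm` is Mathlib's "each element goes to the next one" permutation), and `w` is a
**one-vertex word** (`VertexTransitive w`: the vertex permutation is transitive on the letters) when all its letters lie in one cycle — the only case in which
`⟨symbols ∣ w⟩` is the fundamental group of the closed surface with boundary word `w` computed at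
its unique vertex.  This file has the definitions (`bar`, `barPerm`, `vertexPerm`, `Closed`,
`VertexTransitive`) and the invariance under rotation.  The letters formalism is the one suited
to SYSTEMS of words (several faces, deletions, gluings: the permutations live on one fixed type
of letters); the position formalism of a single cyclic word (`vertexMap`, `OneVertex` of
`QuadraticWordsVertices.lean`, seat abc-iut-L5-t16) is equivalent for duplicate-free words, the
bridge being `VertexTransitive w → OneVertex w`; the calculus (connected sums, transport moves,
the interlinking oracle, block words) is in `QuadraticWordsVertexCalculus.lean` and
`QuadraticWordsVertexTransport.lean`.

## References

* H. Zieschang, E. Vogt, H.-D. Coldewey, *Surfaces and Planar Discontinuous Groups*, LNM 835,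
  Springer 1980, §1.3 (vertices of the surface given by a word), §3.1. [ZieschangVogtColdewey1980]
-/

namespace Literature.GroupTheory.CombinatorialGroupTheory

open List Equiv Equiv.Perm

/-! ### The vertex permutation of a word -/

section Words

variable {ι : Type*} [DecidableEq ι]

/-- The partner (formal inverse) `x̄ = (x.1, !x.2)` of a letter. [folklore] -/
def bar (x : ι × Bool) : ι × Bool := (x.1, !x.2)

omit [DecidableEq ι] in
/-- `bar (i, s) = (i, !s)`. [cite: ZieschangVogtColdewey1980, 3.1.2] -/
@[simp] theorem bar_mk (i : ι) (s : Bool) : bar (i, s) = (i, !s) := rfl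

omit [DecidableEq ι] in
/-- `bar` is an involution. [cite: ZieschangVogtColdewey1980, 3.1.2] -/
@[simp] theorem bar_bar (x : ι × Bool) : bar (bar x) = x := by
  obtain ⟨i, b⟩ := x; simp [bar]

omit [DecidableEq ι] in
/-- A letter is not its own partner. [cite: ZieschangVogtColdewey1980, 3.1.2] -/
theorem bar_ne_self (x : ι × Bool) : bar x ≠ x := by
  obtain ⟨i, b⟩ := x; cases b <;> simp [bar]

omit [DecidableEq ι] in
/-- `bar` is injective. [cite: ZieschangVogtColdewey1980, 3.1.2] -/
theorem bar_injective : Function.Injective (bar : ι × Bool → ι × Bool) :=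
  fun x y h => by rw [← bar_bar x, h, bar_bar]

/-- The partner involution as a permutation of the letters. [folklore] -/
def barPerm : Perm (ι × Bool) := Function.Involutive.toPerm bar bar_bar

omit [DecidableEq ι] in
/-- `barPerm x = x̄`. [cite: ZieschangVogtColdewey1980, 3.1.2] -/
@[simp] theorem barPerm_apply (x : ι × Bool) : (barPerm : Perm (ι × Bool)) x = bar x := rfl

omit [DecidableEq ι] in
/-- `barPerm` is its own inverse. [cite: ZieschangVogtColdewey1980, 3.1.2] -/
@[simp] theorem barPerm_inv : (barPerm : Perm (ι × Bool))⁻¹ = barPerm :=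
  Perm.ext fun x => by rw [Perm.inv_eq_iff_eq, barPerm_apply, barPerm_apply, bar_bar]

/-- **The vertex permutation** of a word: a letter `x` (naming the corner in front of it) goes to
the cyclic successor of its partner `x̄` (the corner behind `x̄`, identified with it when the sides
`x`, `x̄` of the polygon are glued; ZVC §1.3). [cite: ZieschangVogtColdewey1980, §1.3] -/
def vertexPerm (w : List (ι × Bool)) : Perm (ι × Bool) := w.formPerm * barPerm

/-- `vertexPerm w x = formPerm w x̄`. [cite: ZieschangVogtColdewey1980, 3.1.2] -/
@[simp] theorem vertexPerm_apply (w : List (ι × Bool)) (x : ι × Bool) :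
    vertexPerm w x = w.formPerm (bar x) := rfl

/-- A word is **closed** if it contains the partner of each of its letters (e.g. a quadratic
word, or a product of quadratic words). [cite: ZieschangVogtColdewey1980, 3.1.1 (c)] -/
def Closed (w : List (ι × Bool)) : Prop := ∀ x ∈ w, bar x ∈ w

/-- A quadratic word is closed. [cite: ZieschangVogtColdewey1980, 3.1.2] -/
theorem IsQuadratic.closed {w : List (ι × Bool)} (h : IsQuadratic w) : Closed w :=
  fun _ hx => h.partner_mem hx

/-- A quadratic word has no repeated letter. [cite: ZieschangVogtColdewey1980, 3.1.2] -/
theorem IsQuadratic.nodup {w : List (ι × Bool)} (h : IsQuadratic w) : w.Nodup :=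
  nodup_iff_count_le_one.2 fun x => h.count_le_one x

omit [DecidableEq ι] in
/-- Closedness only depends on the set of letters. [cite: ZieschangVogtColdewey1980, 3.1.2] -/
theorem Closed.of_perm {w w' : List (ι × Bool)} (h : Closed w) (hp : w ~ w') : Closed w' :=
  fun x hx => hp.mem_iff.1 (h x (hp.mem_iff.2 hx))

omit [DecidableEq ι] in
/-- A concatenation of closed words is closed. [cite: ZieschangVogtColdewey1980, 3.1.2] -/
theorem Closed.append {M N : List (ι × Bool)} (hM : Closed M) (hN : Closed N) : Closed (M ++ N) := by
  intro x hx
  rcases mem_append.1 hx with hx | hx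
  · exact mem_append_left _ (hM x hx)
  · exact mem_append_right _ (hN x hx)

/-- The vertex permutation of a closed word preserves its letters. [cite: ZieschangVogtColdewey1980, 3.1.2] -/
theorem Closed.vertexPerm_apply_mem {w : List (ι × Bool)} (hc : Closed w) {x : ι × Bool} (hx : x ∈ w) :
    vertexPerm w x ∈ w :=
  formPerm_apply_mem_of_mem (hc x hx)

/-- **One-vertex word**: all letters (= corners of the polygon) lie in one cycle of the vertex
permutation — the polygon with sides glued according to `w` has a single vertex.
[cite: ZieschangVogtColdewey1980, §1.3] -/
def VertexTransitive (w : List (ι × Bool)) : Prop :=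
  ∀ x ∈ w, ∀ y ∈ w, (vertexPerm w).SameCycle x y

/-- The empty word is (vacuously) one-vertex. [cite: ZieschangVogtColdewey1980, 3.1.3] -/
theorem vertexTransitive_nil : VertexTransitive ([] : List (ι × Bool)) := fun x hx => by simp at hx

/-- The vertex permutation only depends on the cyclic word. [cite: ZieschangVogtColdewey1980, 3.1.2] -/
theorem vertexPerm_eq_of_isRotated {w w' : List (ι × Bool)} (hd : w.Nodup) (h : w ~r w') :
    vertexPerm w = vertexPerm w' := by
  rw [vertexPerm, vertexPerm, formPerm_eq_of_isRotated hd h]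

/-- `VertexTransitive` only depends on the cyclic word. [cite: ZieschangVogtColdewey1980, 3.1.2] -/
theorem vertexTransitive_iff_of_isRotated {w w' : List (ι × Bool)} (hd : w.Nodup) (h : w ~r w') :
    VertexTransitive w ↔ VertexTransitive w' := by
  simp only [VertexTransitive, vertexPerm_eq_of_isRotated hd h, h.perm.mem_iff]

/-- `VertexTransitive (M ++ N) ↔ VertexTransitive (N ++ M)`. [cite: ZieschangVogtColdewey1980, 3.1.2] -/
theorem vertexTransitive_append_comm {M N : List (ι × Bool)} (hd : (M ++ N).Nodup) :
    VertexTransitive (M ++ N) ↔ VertexTransitive (N ++ M) :=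
  vertexTransitive_iff_of_isRotated hd isRotated_append

end Words

end Literature.GroupTheory.CombinatorialGroupTheory
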